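import Summits.RiemannHypothesis.RiemannHypothesis.Theorems.HandoffDipoleChebyshev
import Summits.RiemannHypothesis.RiemannHypothesis.Theorems.HandoffCrossArch
import Summits.RiemannHypothesis.RiemannHypothesis.Theorems.HandoffFailingStep
import HarnessLib

/-!
# HANDOFF — the ARITHMETIC SHADOW of a window: Weil positivity on `C(a)` gives the two-sided RH explicit-formula
# inequality for every smoothed Chebyshev sum below `e^{2a}` (cell rh-explicit, TRACK «HANDOFF», seat prove-2 gen4, ATTEMPT-11)

HONEST FRAMING. Nothing here proves or approaches RH. This file says, in the kernel, exactly which ARITHMETIC statements a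
certified window `WeilPositivityOn a` (equivalently a rung `H(q)` of the handoff ladder, `a = (log q⁺)/2`) implies about the
primes below `e^{2a}`; every statement is an RH-consequence, proved here from the window alone (RH-free bookkeeping).

For a smooth bump `ψ` at `0` of outer radius `r`, its autocorrelation `φ = ψ ⋆ ψ̃` and a scale `L > 2r` (think `x = e^{L}`), put
`S_ψ(L) := Re Σ_n Λ(n) n^{−1/2} φ(log n − L)` (the `√x`-normalised Chebyshev sum smoothed by `φ` around `n ≈ x`) and
`M_ψ(L) := (e^{L/2} + e^{−L/2})·Re φ̂(1)` (its main term). Under RH the explicit formula for `φ(· − L)` reads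
`M_ψ(L) − S_ψ(L) + W_∞(φ(· − L)) = Σ_γ e^{iγL}|ψ̂(½ + iγ)|²`, whose modulus is at most `Σ_γ |ψ̂(½+iγ)|² = Q(ψ)`.

* `abs_chebyshev_sub_main_le` — **THE TWO-SIDED SHADOW.** `WeilPositivityOn (L/2 + r)` alone implies
  `|S_ψ(L) − M_ψ(L)| ≤ Re Q(ψ) + 8 r·M(L/2 − r)·‖ψ‖₂²`, `M(c′) = archGapBound c′ = e^{−c′}/(1 − e^{−4c′})` — the SAME
  fluctuation allowance `Q(ψ)` as under RH, plus the (exponentially small in `L`) archimedean cross term. Mechanism: Weil's form on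
  the symmetric AND the antisymmetric two-layer pairs `ψ(· − L/2) ± ψ(· + L/2)` (theory-2's dipole `HandoffDipoleChebyshev` gave the
  `+` pair with an `L`-independent archimedean constant; here both signs and the separated-support archimedean bound
  `norm_weilArchTerm_cross_le` of this seat's `HandoffCrossArch`).
* `abs_chebyshev_sub_main_le_of_handoffH` — the handoff reading: the rung `H(q)` certifies the inequality for every `(ψ, L)` with
  `L/2 + r ≤ (log q⁺)/2`; the INCREMENT `H′(q)` adds exactly the scales `log q < L + 2r ≤ log q⁺`.
* `log_lt_of_not_handoffStep_of_violation` — contrapositive for ROUTE 1′: a violated inequality at `(ψ, L)` puts theory-1's unique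
  failing prime (`HandoffFailingStep.eq_of_not_handoffStep`) below `e^{L + 2r}`.
* `abs_chebyshev_sub_main_le_of_riemannHypothesis` — the RH side for comparison (via the tree's `RH → WeilPositivityOn a`).

References: H. L. Montgomery, R. C. Vaughan, Multiplicative Number Theory I (2007) §13.1 (explicit formula for smoothed sums under
RH: Thm 13.3 (Cramér) and its proof (13.11)–(13.13), the triangular-weight smoothed Chebyshev sum — the printed twin of the two-sided bound;
§15.1 = Landau's theorem, the converse direction, see `HandoffPrimeShadowCriterion`; `MontgomeryVaughan2007`); E. Bombieri, Rend. Mat. Acc. Lincei (9) 11 (2000) §3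
(the hermitian form), Thm 2 (archimedean term) (`Bombieri2000Weil`). NO new definitions (statements written out).
-/

set_option linter.dupNamespace false  -- the mandated namespace repeats `RiemannHypothesis`

noncomputable section

open Set Filter Complex MeasureTheory Literature.NumberTheory.LFunctions
open Summit.RiemannHypothesis.RiemannHypothesis.Theorems.Handoff
open Summit.RiemannHypothesis.RiemannHypothesis.Theorems.HandoffCapSharp
open Summit.RiemannHypothesis.RiemannHypothesis.Theorems.HandoffBumpAutocorr
open Summit.RiemannHypothesis.RiemannHypothesis.Theorems.HandoffDipoleChebyshev
open scoped Real ComplexConjugate ArithmeticFunction.vonMangoldt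

namespace Summit.RiemannHypothesis.RiemannHypothesis.Theorems.HandoffPrimeShadow

variable (ψ : ContDiffBump (0 : ℝ)) {L : ℝ}

/-! ## §1 The two layers `ψ(· ∓ L/2)` as translates: test functions, supports, masses -/

/-- Support of a translated bump layer: `tsupport ψ(· − c) ⊆ [c − r, c + r]`. [folklore] -/
theorem tsupport_translate_bump_subset (c : ℝ) :
    tsupport (weilTranslate (fun x : ℝ ↦ ((ψ x : ℝ) : ℂ)) c) ⊆ Icc (c - ψ.rOut) (c + ψ.rOut) := by
  refine closure_minimal (fun x hx ↦ ?_) isClosed_Icc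
  have hx' : ψ (x - c) ≠ 0 := fun h0 ↦ hx (by simp [weilTranslate, h0])
  have h := abs_lt_rOut_of_ne_zero ψ hx'
  rw [abs_lt] at h
  constructor <;> linarith [h.1, h.2]

/-- `‖ψ(· − c)‖₂² = ‖ψ‖₂²`. [folklore] -/
theorem integral_norm_sq_translate_bump (c : ℝ) :
    ∫ u : ℝ, ‖weilTranslate (fun x : ℝ ↦ ((ψ x : ℝ) : ℂ)) c u‖ ^ 2 = ∫ y : ℝ, ψ y ^ 2 := by
  have e : (fun u : ℝ ↦ ‖weilTranslate (fun x : ℝ ↦ ((ψ x : ℝ) : ℂ)) c u‖ ^ 2) = fun u : ℝ ↦ (fun y : ℝ ↦ ψ y ^ 2) (u - c) := by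
    funext u
    simp only [weilTranslate, Complex.norm_real, Real.norm_eq_abs, sq_abs]
  rw [e, integral_sub_right_eq_self (fun y : ℝ ↦ ψ y ^ 2) c]

/-- Support of the two-layer combination `ψ(· − L/2) + t·ψ(· + L/2)`: inside `[−(L/2 + r), L/2 + r]` (`L ≥ 0`). [folklore] -/
theorem tsupport_twoLayer_subset (hL : 0 ≤ L) (t : ℝ) :
    tsupport (weilTranslate (fun x : ℝ ↦ ((ψ x : ℝ) : ℂ)) (L / 2) +
        fun x ↦ (t : ℂ) * weilTranslate (fun x : ℝ ↦ ((ψ x : ℝ) : ℂ)) (-(L / 2)) x) ⊆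
      Icc (-(L / 2 + ψ.rOut)) (L / 2 + ψ.rOut) := by
  have hr := ψ.rOut_pos
  have h1 := tsupport_translate_bump_subset ψ (L / 2)
  have h2 : tsupport (fun x ↦ (t : ℂ) * weilTranslate (fun x : ℝ ↦ ((ψ x : ℝ) : ℂ)) (-(L / 2)) x) ⊆
      Icc (-(L / 2) - ψ.rOut) (-(L / 2) + ψ.rOut) :=
    (tsupport_mul_subset_right (f := fun _ : ℝ ↦ (t : ℂ))
      (g := weilTranslate (fun x : ℝ ↦ ((ψ x : ℝ) : ℂ)) (-(L / 2)))).trans (tsupport_translate_bump_subset ψ (-(L / 2)))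
  refine (tsupport_add (weilTranslate (fun x : ℝ ↦ ((ψ x : ℝ) : ℂ)) (L / 2))
    (fun x ↦ (t : ℂ) * weilTranslate (fun x : ℝ ↦ ((ψ x : ℝ) : ℂ)) (-(L / 2)) x)).trans ?_
  refine union_subset (h1.trans (Icc_subset_Icc (by linarith) le_rfl)) (h2.trans (Icc_subset_Icc (by linarith) (by linarith)))

/-! ## §2 Weil's functional on the far translates `φ(· ∓ L)` of the autocorrelation, EXACTLY -/

/-- The archimedean terms of the two far translates agree: `W_∞(φ(· + L)) = W_∞(φ(· − L))` (Bombieri's form sees only `k(0)`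
and `k(t) + k(−t)`, and `φ` is even). [cite: Bombieri2000Weil, Thm 2 (archimedean term)] -/
theorem weilArchTerm_translate_autocorr_neg (L : ℝ) :
    weilArchTerm (weilTranslate (weilConv (fun x : ℝ ↦ ((ψ x : ℝ) : ℂ)) (weilReflect fun x : ℝ ↦ ((ψ x : ℝ) : ℂ))) (-L)) =
      weilArchTerm (weilTranslate (weilConv (fun x : ℝ ↦ ((ψ x : ℝ) : ℂ)) (weilReflect fun x : ℝ ↦ ((ψ x : ℝ) : ℂ))) L) := by
  have hφt := isWeilTest_autocorr ψ
  rw [← weilArchTermBombieri_eq_weilArchTerm_holds (hφt.weilTranslate (-L)),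
    ← weilArchTermBombieri_eq_weilArchTerm_holds (hφt.weilTranslate L)]
  unfold weilArchTermBombieri weilTranslate
  have h0 : (weilConv (fun x : ℝ ↦ ((ψ x : ℝ) : ℂ)) (weilReflect fun x : ℝ ↦ ((ψ x : ℝ) : ℂ))) (0 - -L) =
      (weilConv (fun x : ℝ ↦ ((ψ x : ℝ) : ℂ)) (weilReflect fun x : ℝ ↦ ((ψ x : ℝ) : ℂ))) (0 - L) := by
    rw [show (0 : ℝ) - -L = -(0 - L) by ring, autocorr_neg]
  have hsum : ∀ t : ℝ,
      (weilConv (fun x : ℝ ↦ ((ψ x : ℝ) : ℂ)) (weilReflect fun x : ℝ ↦ ((ψ x : ℝ) : ℂ))) (t - -L) +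
          (weilConv (fun x : ℝ ↦ ((ψ x : ℝ) : ℂ)) (weilReflect fun x : ℝ ↦ ((ψ x : ℝ) : ℂ))) (-t - -L) =
        (weilConv (fun x : ℝ ↦ ((ψ x : ℝ) : ℂ)) (weilReflect fun x : ℝ ↦ ((ψ x : ℝ) : ℂ))) (t - L) +
          (weilConv (fun x : ℝ ↦ ((ψ x : ℝ) : ℂ)) (weilReflect fun x : ℝ ↦ ((ψ x : ℝ) : ℂ))) (-t - L) := by
    intro t
    rw [show t - -L = -(-t - L) by ring, autocorr_neg, show -t - -L = -(t - L) by ring, autocorr_neg, add_comm]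
  rw [h0]
  congr 2
  refine setIntegral_congr_fun measurableSet_Ioi fun t _ ↦ ?_
  rw [hsum t]

/-- **Weil's functional on `φ(· − L)`, real part, EXACTLY** (`2r < L`):
`Re W(φ(· − L)) = (e^{L/2} + e^{−L/2})·Re φ̂(1) − Re Σ_n Λ(n)n^{−1/2}φ(log n − L) + Re W_∞(φ(· − L))`. [folklore] -/
theorem re_weilFunctional_translate_autocorr (hL : 2 * ψ.rOut < L) :
    (weilFunctional (weilTranslate (weilConv (fun x : ℝ ↦ ((ψ x : ℝ) : ℂ)) (weilReflect fun x : ℝ ↦ ((ψ x : ℝ) : ℂ))) L)).re =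
      (Real.exp (L / 2) + Real.exp (-(L / 2))) *
          (weilMellin (weilConv (fun x : ℝ ↦ ((ψ x : ℝ) : ℂ)) (weilReflect fun x : ℝ ↦ ((ψ x : ℝ) : ℂ))) 1).re -
        (∑' n : ℕ, ((Λ n : ℝ) : ℂ) / (Real.sqrt n : ℂ) *
            (weilConv (fun x : ℝ ↦ ((ψ x : ℝ) : ℂ)) (weilReflect fun x : ℝ ↦ ((ψ x : ℝ) : ℂ))) (Real.log n - L)).re +
        (weilArchTerm (weilTranslate (weilConv (fun x : ℝ ↦ ((ψ x : ℝ) : ℂ)) (weilReflect fun x : ℝ ↦ ((ψ x : ℝ) : ℂ))) L)).re := by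
  unfold weilFunctional
  rw [Complex.add_re, Complex.sub_re, weilPolarTerm_translate, Complex.re_ofReal_mul, weilPrimeTerm_translate ψ hL]

/-- **Weil's functional on `φ(· + L)`, real part, EXACTLY** (`2r < L`): the same three terms (the mirrored translate sees the same
atoms, has the same polar term, and the same archimedean term). [folklore] -/
theorem re_weilFunctional_translate_autocorr_neg (hL : 2 * ψ.rOut < L) :
    (weilFunctional (weilTranslate (weilConv (fun x : ℝ ↦ ((ψ x : ℝ) : ℂ)) (weilReflect fun x : ℝ ↦ ((ψ x : ℝ) : ℂ))) (-L))).re =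
      (Real.exp (L / 2) + Real.exp (-(L / 2))) *
          (weilMellin (weilConv (fun x : ℝ ↦ ((ψ x : ℝ) : ℂ)) (weilReflect fun x : ℝ ↦ ((ψ x : ℝ) : ℂ))) 1).re -
        (∑' n : ℕ, ((Λ n : ℝ) : ℂ) / (Real.sqrt n : ℂ) *
            (weilConv (fun x : ℝ ↦ ((ψ x : ℝ) : ℂ)) (weilReflect fun x : ℝ ↦ ((ψ x : ℝ) : ℂ))) (Real.log n - L)).re +
        (weilArchTerm (weilTranslate (weilConv (fun x : ℝ ↦ ((ψ x : ℝ) : ℂ)) (weilReflect fun x : ℝ ↦ ((ψ x : ℝ) : ℂ))) L)).re := by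
  unfold weilFunctional
  rw [Complex.add_re, Complex.sub_re, weilPolarTerm_translate, Complex.re_ofReal_mul, weilPrimeTerm_translate_neg ψ hL,
    weilArchTerm_translate_autocorr_neg]
  rw [show -L / 2 = -(L / 2) by ring, neg_neg, add_comm (Real.exp (-(L / 2)))]

/-! ## §3 The archimedean term of the far translate is exponentially small in `L` -/

/-- The far translate of the autocorrelation is the cross kernel of the two layers:
`φ(· − L) = ψ(· − L/2) ⋆ (ψ(· + L/2))~`. [folklore] -/
theorem weilTranslate_autocorr_eq_cross (L : ℝ) :
    weilTranslate (weilConv (fun x : ℝ ↦ ((ψ x : ℝ) : ℂ)) (weilReflect fun x : ℝ ↦ ((ψ x : ℝ) : ℂ))) L =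
      weilConv (weilTranslate (fun x : ℝ ↦ ((ψ x : ℝ) : ℂ)) (L / 2))
        (weilReflect (weilTranslate (fun x : ℝ ↦ ((ψ x : ℝ) : ℂ)) (-(L / 2)))) := by
  funext x
  have h := weilConv_translate_weilReflect_translate ψ (L / 2) (-(L / 2)) x
  rw [show x - (L / 2 - -(L / 2)) = x - L by ring] at h
  rw [show weilTranslate (fun x : ℝ ↦ ((ψ x : ℝ) : ℂ)) (L / 2) = fun y : ℝ ↦ ((ψ (y - L / 2) : ℝ) : ℂ) by
      funext y; simp [weilTranslate],
    show weilTranslate (fun x : ℝ ↦ ((ψ x : ℝ) : ℂ)) (-(L / 2)) = fun y : ℝ ↦ ((ψ (y - -(L / 2)) : ℝ) : ℂ) by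
      funext y; simp [weilTranslate], h]
  rfl

/-- **The archimedean term of `φ(· − L)` is exponentially small**: for `2r < L`,
`‖W_∞(φ(· − L))‖ ≤ 8 r·M(L/2 − r)·‖ψ‖₂²`, `M = archGapBound` (`= e^{−c′}/(1 − e^{−4c′})` at `c′ = L/2 − r`): the layers
`ψ(· ∓ L/2)` live in `[L/2 − r, L/2 + r]` and its mirror, so Bombieri's integrand is supported on lags `t ∈ [L − 2r, L + 2r]` where
`e^{t/2}/(2 sinh t) ≤ M(L/2 − r)`. [cite: Bombieri2000Weil, Thm 2 (archimedean term); this track, ATTEMPT-4 §2 (`norm_weilArchTerm_cross_le`)] -/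
theorem norm_weilArchTerm_translate_autocorr_le (hL : 2 * ψ.rOut < L) :
    ‖weilArchTerm (weilTranslate (weilConv (fun x : ℝ ↦ ((ψ x : ℝ) : ℂ)) (weilReflect fun x : ℝ ↦ ((ψ x : ℝ) : ℂ))) L)‖ ≤
      8 * ψ.rOut * archGapBound (L / 2 - ψ.rOut) * ∫ y : ℝ, ψ y ^ 2 := by
  have hψt := isWeilTest_bump ψ
  have hr := ψ.rOut_pos
  rw [weilTranslate_autocorr_eq_cross]
  have hu := hψt.weilTranslate (L / 2)
  have hh := hψt.weilTranslate (-(L / 2))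
  have hus : tsupport (weilTranslate (fun x : ℝ ↦ ((ψ x : ℝ) : ℂ)) (L / 2)) ⊆ Icc (L / 2 - ψ.rOut) (L / 2 + ψ.rOut) :=
    tsupport_translate_bump_subset ψ (L / 2)
  have hhs : tsupport (weilTranslate (fun x : ℝ ↦ ((ψ x : ℝ) : ℂ)) (-(L / 2))) ⊆
      Icc (-(L / 2 + ψ.rOut)) (-(L / 2 - ψ.rOut)) :=
    (tsupport_translate_bump_subset ψ (-(L / 2))).trans (Icc_subset_Icc (by linarith) (by linarith))
  have h := norm_weilArchTerm_cross_le hu hh (c' := L / 2 - ψ.rOut) (b := L / 2 + ψ.rOut) (by linarith) (by linarith) hus hhs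
  rw [integral_norm_sq_translate_bump, integral_norm_sq_translate_bump] at h
  calc _ ≤ 2 * (L / 2 + ψ.rOut - (L / 2 - ψ.rOut)) * archGapBound (L / 2 - ψ.rOut) *
        ((∫ y : ℝ, ψ y ^ 2) + ∫ y : ℝ, ψ y ^ 2) := h
    _ = 8 * ψ.rOut * archGapBound (L / 2 - ψ.rOut) * ∫ y : ℝ, ψ y ^ 2 := by ring

/-! ## §4 THE TWO-SIDED SHADOW -/

/-- **The cross term of the two layers** (`2r < L`): `crossRe(ψ(· − L/2), ψ(· + L/2)) = M_ψ(L) − S_ψ(L) + Re W_∞(φ(· − L))`. [this track, ATTEMPT-11 §1] -/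
theorem crossRe_twoLayer_eq (hL : 2 * ψ.rOut < L) :
    crossRe (weilTranslate (fun x : ℝ ↦ ((ψ x : ℝ) : ℂ)) (L / 2)) (weilTranslate (fun x : ℝ ↦ ((ψ x : ℝ) : ℂ)) (-(L / 2))) =
      (Real.exp (L / 2) + Real.exp (-(L / 2))) *
          (weilMellin (weilConv (fun x : ℝ ↦ ((ψ x : ℝ) : ℂ)) (weilReflect fun x : ℝ ↦ ((ψ x : ℝ) : ℂ))) 1).re -
        (∑' n : ℕ, ((Λ n : ℝ) : ℂ) / (Real.sqrt n : ℂ) *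
            (weilConv (fun x : ℝ ↦ ((ψ x : ℝ) : ℂ)) (weilReflect fun x : ℝ ↦ ((ψ x : ℝ) : ℂ))) (Real.log n - L)).re +
        (weilArchTerm (weilTranslate (weilConv (fun x : ℝ ↦ ((ψ x : ℝ) : ℂ)) (weilReflect fun x : ℝ ↦ ((ψ x : ℝ) : ℂ))) L)).re := by
  have hψt := isWeilTest_bump ψ
  have hu := hψt.weilTranslate (L / 2)
  have hh := hψt.weilTranslate (-(L / 2))
  have h2 := two_mul_crossRe hu hh
  have hk1 : weilConv (weilTranslate (fun x : ℝ ↦ ((ψ x : ℝ) : ℂ)) (L / 2))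
      (weilReflect (weilTranslate (fun x : ℝ ↦ ((ψ x : ℝ) : ℂ)) (-(L / 2)))) =
      weilTranslate (weilConv (fun x : ℝ ↦ ((ψ x : ℝ) : ℂ)) (weilReflect fun x : ℝ ↦ ((ψ x : ℝ) : ℂ))) L :=
    (weilTranslate_autocorr_eq_cross ψ L).symm
  have hk2 : weilConv (weilTranslate (fun x : ℝ ↦ ((ψ x : ℝ) : ℂ)) (-(L / 2)))
      (weilReflect (weilTranslate (fun x : ℝ ↦ ((ψ x : ℝ) : ℂ)) (L / 2))) =
      weilTranslate (weilConv (fun x : ℝ ↦ ((ψ x : ℝ) : ℂ)) (weilReflect fun x : ℝ ↦ ((ψ x : ℝ) : ℂ))) (-L) := by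
    funext x
    have h := weilConv_translate_weilReflect_translate ψ (-(L / 2)) (L / 2) x
    rw [show x - (-(L / 2) - L / 2) = x - -L by ring] at h
    rw [show weilTranslate (fun x : ℝ ↦ ((ψ x : ℝ) : ℂ)) (L / 2) = fun y : ℝ ↦ ((ψ (y - L / 2) : ℝ) : ℂ) by
        funext y; simp [weilTranslate],
      show weilTranslate (fun x : ℝ ↦ ((ψ x : ℝ) : ℂ)) (-(L / 2)) = fun y : ℝ ↦ ((ψ (y - -(L / 2)) : ℝ) : ℂ) by
        funext y; simp [weilTranslate], h]
    rfl
  rw [hk1, hk2, Complex.add_re, re_weilFunctional_translate_autocorr ψ hL,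
    re_weilFunctional_translate_autocorr_neg ψ hL] at h2
  linarith

/-- **THE TWO-SIDED ARITHMETIC SHADOW OF A WINDOW.** For every bump `ψ` at `0` of outer radius `r`, every `L > 2r`, and Weil
positivity on `C(L/2 + r)` ALONE:
`|S_ψ(L) − M_ψ(L)| ≤ Re Q(ψ) + 8 r·M(L/2 − r)·‖ψ‖₂²`,
`S_ψ(L) = Re Σ_n Λ(n)n^{−1/2}φ(log n − L)`, `M_ψ(L) = (e^{L/2} + e^{−L/2})·Re φ̂(1)`, `φ = ψ ⋆ ψ̃`, `M = archGapBound`. Under RH the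
explicit formula gives `|M − S + W_∞(φ(·−L))| = |Σ_γ e^{iγL}|ψ̂(½+iγ)|²| ≤ Q(ψ)` — the window yields the IDENTICAL fluctuation
allowance. Proof: `0 ≤ Re Q(ψ(·−L/2) ± ψ(·+L/2)) = 2·Re Q(ψ) ± 2·crossRe` and `crossRe = M − S + Re W_∞(φ(·−L))`.
[cite: MontgomeryVaughan2007, §13.1 Thm 13.3 (Cramér) and (13.11)–(13.13) (explicit formula for smoothed sums under RH); this track, ATTEMPT-11 §1] -/
theorem abs_chebyshev_sub_main_le (hL : 2 * ψ.rOut < L) (hW : WeilPositivityOn (L / 2 + ψ.rOut)) :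
    |(∑' n : ℕ, ((Λ n : ℝ) : ℂ) / (Real.sqrt n : ℂ) *
            (weilConv (fun x : ℝ ↦ ((ψ x : ℝ) : ℂ)) (weilReflect fun x : ℝ ↦ ((ψ x : ℝ) : ℂ))) (Real.log n - L)).re -
        (Real.exp (L / 2) + Real.exp (-(L / 2))) *
          (weilMellin (weilConv (fun x : ℝ ↦ ((ψ x : ℝ) : ℂ)) (weilReflect fun x : ℝ ↦ ((ψ x : ℝ) : ℂ))) 1).re| ≤
      (weilQuadratic (fun x : ℝ ↦ ((ψ x : ℝ) : ℂ))).re + 8 * ψ.rOut * archGapBound (L / 2 - ψ.rOut) * ∫ y : ℝ, ψ y ^ 2 := by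
  have hψt := isWeilTest_bump ψ
  have hr := ψ.rOut_pos
  have hL0 : 0 ≤ L := by linarith
  set u := weilTranslate (fun x : ℝ ↦ ((ψ x : ℝ) : ℂ)) (L / 2) with hu_def
  set h := weilTranslate (fun x : ℝ ↦ ((ψ x : ℝ) : ℂ)) (-(L / 2)) with hh_def
  have hu : IsWeilTest u := hψt.weilTranslate (L / 2)
  have hh : IsWeilTest h := hψt.weilTranslate (-(L / 2))
  have hQu : (weilQuadratic u).re = (weilQuadratic (fun x : ℝ ↦ ((ψ x : ℝ) : ℂ))).re := by
    rw [hu_def, show weilTranslate (fun x : ℝ ↦ ((ψ x : ℝ) : ℂ)) (L / 2) = fun y : ℝ ↦ ((ψ (y - L / 2) : ℝ) : ℂ) by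
      funext y; simp [weilTranslate], Handoff.weilQuadratic_translate (fun x : ℝ ↦ ((ψ x : ℝ) : ℂ)) (L / 2)]
  have hQh : (weilQuadratic h).re = (weilQuadratic (fun x : ℝ ↦ ((ψ x : ℝ) : ℂ))).re := by
    rw [hh_def, show weilTranslate (fun x : ℝ ↦ ((ψ x : ℝ) : ℂ)) (-(L / 2)) = fun y : ℝ ↦ ((ψ (y - -(L / 2)) : ℝ) : ℂ) by
      funext y; simp [weilTranslate], Handoff.weilQuadratic_translate (fun x : ℝ ↦ ((ψ x : ℝ) : ℂ)) (-(L / 2))]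
  have hpos : ∀ t : ℝ, 0 ≤ (weilQuadratic (u + fun x ↦ (t : ℂ) * h x)).re := fun t ↦
    hW _ (hu.add (hh.const_mul (t : ℂ))) (tsupport_twoLayer_subset ψ hL0 t)
  have hp1 := hpos 1
  have hm1 := hpos (-1)
  rw [re_weilQuadratic_add_real_mul hu hh, hQu, hQh] at hp1 hm1
  have hX := crossRe_twoLayer_eq ψ hL
  have hA := (Complex.abs_re_le_norm _).trans (norm_weilArchTerm_translate_autocorr_le ψ hL)
  rw [abs_le] at hA ⊢
  constructor <;> nlinarith [hA.1, hA.2, hp1, hm1, hX]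

/-! ## §5 The handoff reading and the ROUTE 1′ contrapositive -/

/-- **What a rung certifies.** For a prime `q` with `H(q)` (Weil positivity on `C((log q⁺)/2)`): every pair `(ψ, L)` with
`2r < L` and `L/2 + r ≤ (log q⁺)/2` obeys the two-sided inequality — i.e. every `φ`-smoothed Chebyshev sum at every
`x = e^{L} ≤ q⁺·e^{−2r}` is within `Q(ψ) + 8rM‖ψ‖²` of its main term. [this track, ATTEMPT-11 §2] -/
theorem abs_chebyshev_sub_main_le_of_handoffH {q : ℕ} (hq : q.Prime) (hH : HandoffDecomposition.HandoffH q)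
    (hL : 2 * ψ.rOut < L) (hLq : L / 2 + ψ.rOut ≤ Real.log (HandoffDecomposition.nextPrime q) / 2) :
    |(∑' n : ℕ, ((Λ n : ℝ) : ℂ) / (Real.sqrt n : ℂ) *
            (weilConv (fun x : ℝ ↦ ((ψ x : ℝ) : ℂ)) (weilReflect fun x : ℝ ↦ ((ψ x : ℝ) : ℂ))) (Real.log n - L)).re -
        (Real.exp (L / 2) + Real.exp (-(L / 2))) *
          (weilMellin (weilConv (fun x : ℝ ↦ ((ψ x : ℝ) : ℂ)) (weilReflect fun x : ℝ ↦ ((ψ x : ℝ) : ℂ))) 1).re| ≤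
      (weilQuadratic (fun x : ℝ ↦ ((ψ x : ℝ) : ℂ))).re + 8 * ψ.rOut * archGapBound (L / 2 - ψ.rOut) * ∫ y : ℝ, ψ y ^ 2 :=
  abs_chebyshev_sub_main_le ψ hL
    (((HandoffDecomposition.handoffH_iff_weilPositivityOn hq).1 hH).mono hLq)

/-- **A violation kills every window above it.** If the two-sided inequality FAILS at `(ψ, L)` (`2r < L`), then Weil positivity
fails on `C(a)` for every `a ≥ L/2 + r`. [this track, ATTEMPT-11 §2] -/
theorem not_weilPositivityOn_of_violation (hL : 2 * ψ.rOut < L)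
    (hviol : (weilQuadratic (fun x : ℝ ↦ ((ψ x : ℝ) : ℂ))).re +
        8 * ψ.rOut * archGapBound (L / 2 - ψ.rOut) * ∫ y : ℝ, ψ y ^ 2 <
      |(∑' n : ℕ, ((Λ n : ℝ) : ℂ) / (Real.sqrt n : ℂ) *
            (weilConv (fun x : ℝ ↦ ((ψ x : ℝ) : ℂ)) (weilReflect fun x : ℝ ↦ ((ψ x : ℝ) : ℂ))) (Real.log n - L)).re -
        (Real.exp (L / 2) + Real.exp (-(L / 2))) *
          (weilMellin (weilConv (fun x : ℝ ↦ ((ψ x : ℝ) : ℂ)) (weilReflect fun x : ℝ ↦ ((ψ x : ℝ) : ℂ))) 1).re|)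
    {a : ℝ} (ha : L / 2 + ψ.rOut ≤ a) : ¬ WeilPositivityOn a := fun hW ↦
  absurd (abs_chebyshev_sub_main_le ψ hL (hW.mono ha)) (not_le.2 hviol)

/-- **ROUTE 1′ contrapositive: a violation bounds the failing prime.** If the inequality fails at `(ψ, L)` and the handoff
increment fails at the prime `q` (theory-1: there is at most one such prime, `HandoffFailingStep.eq_of_not_handoffStep`), then
`log q < L + 2r`, i.e. `q < e^{L}·e^{2r}`: the failing prime sits below the first violated smoothed-Chebyshev inequality.
(`¬H′(q)` contains `WeilPositivityOn((log q)/2)`, incompatible with a violation at level `L/2 + r ≤ (log q)/2`.) [this track, ATTEMPT-11 §2] -/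
theorem log_lt_of_not_handoffStep_of_violation (hL : 2 * ψ.rOut < L)
    (hviol : (weilQuadratic (fun x : ℝ ↦ ((ψ x : ℝ) : ℂ))).re +
        8 * ψ.rOut * archGapBound (L / 2 - ψ.rOut) * ∫ y : ℝ, ψ y ^ 2 <
      |(∑' n : ℕ, ((Λ n : ℝ) : ℂ) / (Real.sqrt n : ℂ) *
            (weilConv (fun x : ℝ ↦ ((ψ x : ℝ) : ℂ)) (weilReflect fun x : ℝ ↦ ((ψ x : ℝ) : ℂ))) (Real.log n - L)).re -
        (Real.exp (L / 2) + Real.exp (-(L / 2))) *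
          (weilMellin (weilConv (fun x : ℝ ↦ ((ψ x : ℝ) : ℂ)) (weilReflect fun x : ℝ ↦ ((ψ x : ℝ) : ℂ))) 1).re|)
    {q : ℕ} (hq : q.Prime) (hfail : ¬ HandoffDecomposition.HandoffStep q) : Real.log q < L + 2 * ψ.rOut := by
  rw [HandoffDecomposition.not_handoffStep_iff hq] at hfail
  by_contra hge
  rw [not_lt] at hge
  exact not_weilPositivityOn_of_violation ψ hL hviol (a := Real.log q / 2) (by linarith) hfail.1

/-- **The RH side, for comparison**: under RH the two-sided inequality holds for EVERY `L > 2r` (through the tree's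
`RH → WeilPositivityOn a`; the direct route is the explicit formula, `|Σ_γ e^{iγL}|ψ̂(½+iγ)|²| ≤ Σ_γ|ψ̂(½+iγ)|² = Q(ψ)`).
[cite: MontgomeryVaughan2007, §13.1; Bombieri2000Weil, Thm. 2 (⇒)] -/
theorem abs_chebyshev_sub_main_le_of_riemannHypothesis (hRH : Summit.RiemannHypothesis) (hL : 2 * ψ.rOut < L) :
    |(∑' n : ℕ, ((Λ n : ℝ) : ℂ) / (Real.sqrt n : ℂ) *
            (weilConv (fun x : ℝ ↦ ((ψ x : ℝ) : ℂ)) (weilReflect fun x : ℝ ↦ ((ψ x : ℝ) : ℂ))) (Real.log n - L)).re -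
        (Real.exp (L / 2) + Real.exp (-(L / 2))) *
          (weilMellin (weilConv (fun x : ℝ ↦ ((ψ x : ℝ) : ℂ)) (weilReflect fun x : ℝ ↦ ((ψ x : ℝ) : ℂ))) 1).re| ≤
      (weilQuadratic (fun x : ℝ ↦ ((ψ x : ℝ) : ℂ))).re + 8 * ψ.rOut * archGapBound (L / 2 - ψ.rOut) * ∫ y : ℝ, ψ y ^ 2 :=
  abs_chebyshev_sub_main_le ψ hL
    (MotivicDoor.Rungs.rung_of_riemannHypothesis hRH (by linarith [ψ.rOut_pos]))

end Summit.RiemannHypothesis.RiemannHypothesis.Theorems.HandoffPrimeShadow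

end
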